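import Mathlib
import HarnessLib.Audit
import Summits.PneNP.PneNP.Theorems.PstarChordBridgeTools

/-!
# Half-chord bridge, tools: the G-constraint split over an arbitrary set of private variables (ROUND-24, O1; target `TerminalPeelable`)

FRONTIER range-avoidance ladder, rung F-N3, ROUND 24 (cell `pnp-ideate`, planner memo `r24/CORE-BOUND-NOTES.md` §7 G1 / §11 (N3), prover-2
`O1-SCOPING.md` §3–§5 (S-O1b); typed target `PstarCoreBoundTargets.TerminalPeelable` (p646951); restricted-model proof complexity — nothing here
bears on `P` versus `NP`).

`PstarChordBridgeTools.bit_gval_eq` splits a G-constraint over the forest `F = J₀ ∖ N` into a state-free part and the reads of the PRIVATES of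
the chords, grouped chord by chord — which needs every co-edge to be a chord (Assumption A).  Here the same telescoping identity is proved for
an ARBITRARY set `P` of AND-typed variables (`bit_gval_eq_P`): `gval(C,G)(z) = freeP(x) + Σ_{v ∈ P} x_v · coef(v)(x)`, `x = bit ∘ z`, whenever `z`
solves the forest outputs, `T ⊆ F` joins the XOR reads, `P` avoids the XOR vertices of `F`, and no monomial of `G` has both variables in `P`.
With `P` := the GENUINE privates of a co-edge set containing half-chords (one private each) this is the value formula of the half-chord model
(`PstarHalfChordSystem`); the instance construction is the sequel.
-/

set_option linter.dupNamespace false -- `Summit.PneNP.PneNP.…`: summit = sub-problem name (D-0017 single-conjunct layout)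

open Finset Literature.Computability.Complexity
open Summit.PneNP.PneNP.Theorems.PstarFibrePolys (bit bit_xor bit_and bit_injective)
open Summit.PneNP.PneNP.Theorems.PstarPDT (parity bit_eval)
open Summit.PneNP.PneNP.Theorems.PstarTyped (Typed)
open Summit.PneNP.PneNP.Theorems.PstarSALevel (varSet bdry)
open Summit.PneNP.PneNP.Theorems.PstarGapOneAll (gval)
open Summit.PneNP.PneNP.Theorems.PstarGConstraint (bit_gval)
open Summit.PneNP.PneNP.Theorems.PstarXCore (xpair xverts mem_xpair)
open Summit.PneNP.PneNP.Theorems.PstarChordBridgeTools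

namespace Summit.PneNP.PneNP.Theorems.PstarHalfChordBridgeTools

variable {n m : ℕ}

/-- The STATE-FREE PART of the G-constraint `(C, G)` relative to the forest `F`, a set `P` of private variables and the join `T ⊆ F`: linear reads
that are neither XOR vertices of `F` nor in `P`, the join's sum, and the monomials of `G` avoiding `P`. -/
def freeP (I : LocalMap 4 n m) (y : Fin m → Bool) (F : Finset (Fin m)) (P : Finset (Fin n)) (T : Finset (Fin m)) (C : Finset (Fin n))
    (G : Finset (Fin m)) (x : Fin n → ZMod 2) : ZMod 2 :=
  ∑ v ∈ C.filter (fun v => v ∉ xverts I F ∧ v ∉ P), x v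
    + ∑ j ∈ T, (bit (y j) + x (I.vars j 2) * x (I.vars j 3))
    + ∑ g ∈ G.filter (fun g => ¬ (I.vars g 2 ∈ P ∨ I.vars g 3 ∈ P)), x (I.vars g 2) * x (I.vars g 3)

/-- **The G-constraint value split over an arbitrary private set** (the P-form of `PstarChordBridgeTools.bit_gval_eq`). -/
theorem bit_gval_eq_P (I : LocalMap 4 n m) (hI : I.IsPure xorAndPred) (y : Fin m → Bool) {F T : Finset (Fin m)} (hTF : T ⊆ F)
    {P : Finset (Fin n)} (hPx : ∀ v ∈ P, v ∉ xverts I F) (C : Finset (Fin n)) (G : Finset (Fin m))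
    (hjoin : ∀ w, Odd (xpdeg I T w) ↔ w ∈ C ∧ w ∈ xverts I F) (hcross : ∀ g ∈ G, ¬ (I.vars g 2 ∈ P ∧ I.vars g 3 ∈ P))
    {z : Fin n → Bool} (hz : ∀ j ∈ F, I.eval z j = y j) :
    bit (gval I C G z) = freeP I y F P T C G (fun v => bit (z v)) + ∑ v ∈ P, bit (z v) * coef I C G v (fun v => bit (z v)) := by
  classical
  set x : Fin n → ZMod 2 := fun v => bit (z v) with hx
  -- the linear part, split three ways
  have hC : ∑ v ∈ C, x v = ∑ j ∈ T, (bit (y j) + x (I.vars j 2) * x (I.vars j 3))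
      + ∑ v ∈ C.filter (fun v => v ∉ xverts I F ∧ v ∉ P), x v + ∑ v ∈ P, (if v ∈ C then x v else 0) := by
    rw [← sum_filter_add_sum_filter_not C (fun v => v ∈ xverts I F)]
    have h1 : ∑ v ∈ C.filter (fun v => v ∈ xverts I F), x v = ∑ j ∈ T, (bit (y j) + x (I.vars j 2) * x (I.vars j 3)) := by
      have hset : C.filter (fun v => v ∈ xverts I F) = univ.filter (fun w => Odd (xpdeg I T w)) := by
        ext w
        simp only [mem_filter, mem_univ, true_and, hjoin]
      rw [hset, ← sum_pair_eq_sum_filter_odd]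
      exact sum_congr rfl fun j hj => pair_eq_of_eval I hI (hz j (hTF hj))
    have h2 : ∑ v ∈ C.filter (fun v => ¬ v ∈ xverts I F), x v =
        ∑ v ∈ C.filter (fun v => v ∉ xverts I F ∧ v ∉ P), x v + ∑ v ∈ P, (if v ∈ C then x v else 0) := by
      rw [← sum_filter_add_sum_filter_not (C.filter (fun v => ¬ v ∈ xverts I F)) (fun v => v ∉ P), filter_filter, filter_filter]
      congr 1
      rw [← sum_filter]
      apply sum_congr _ (fun _ _ => rfl)
      ext v
      simp only [mem_filter, not_not]
      constructor
      · rintro ⟨hvC, -, hvp⟩; exact ⟨hvp, hvC⟩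
      · rintro ⟨hvp, hvC⟩; exact ⟨hvC, hPx v hvp, hvp⟩
    rw [h1, h2, add_assoc]
  -- the monomial part, split two ways
  have hG : ∑ g ∈ G, x (I.vars g 2) * x (I.vars g 3) =
      ∑ g ∈ G.filter (fun g => ¬ (I.vars g 2 ∈ P ∨ I.vars g 3 ∈ P)), x (I.vars g 2) * x (I.vars g 3)
      + ∑ v ∈ P, x v * ∑ g ∈ G, ((if I.vars g 2 = v then x (I.vars g 3) else 0) + (if I.vars g 3 = v then x (I.vars g 2) else 0)) := by
    have hswap : ∑ v ∈ P, x v * ∑ g ∈ G, ((if I.vars g 2 = v then x (I.vars g 3) else 0) + (if I.vars g 3 = v then x (I.vars g 2) else 0))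
        = ∑ g ∈ G, ((if I.vars g 2 ∈ P then x (I.vars g 2) * x (I.vars g 3) else 0)
            + (if I.vars g 3 ∈ P then x (I.vars g 2) * x (I.vars g 3) else 0)) := by
      simp_rw [mul_sum]
      rw [sum_comm]
      refine sum_congr rfl fun g _ => ?_
      rw [sum_congr rfl fun v _ => mul_add (x v) _ _, sum_add_distrib]
      congr 1
      · simp only [mul_ite, mul_zero, sum_ite_eq]
      · simp only [mul_ite, mul_zero, sum_ite_eq]
        split_ifs
        · exact mul_comm _ _
        · rfl
    rw [hswap, ← sum_filter_add_sum_filter_not G (fun g => ¬ (I.vars g 2 ∈ P ∨ I.vars g 3 ∈ P))]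
    congr 1
    rw [sum_filter]
    refine sum_congr rfl fun g hg => ?_
    by_cases h2 : I.vars g 2 ∈ P <;> by_cases h3 : I.vars g 3 ∈ P
    · exact absurd ⟨h2, h3⟩ (hcross g hg)
    · simp [h2, h3]
    · simp [h2, h3]
    · simp [h2, h3]
  rw [bit_gval, hC, hG]
  unfold freeP coef
  simp only [hx, mul_add, sum_add_distrib, mul_ite, mul_one, mul_zero]
  ring

/-- The state-free part does not read the variables of `P` nor the XOR vertices of `F` (congruence). -/
theorem freeP_congr (I : LocalMap 4 n m) (hT : Typed I) (y : Fin m → Bool) {F T : Finset (Fin m)} (hTF : T ⊆ F) (P : Finset (Fin n))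
    (hPF : ∀ j ∈ F, I.vars j 2 ∉ P ∧ I.vars j 3 ∉ P) (C : Finset (Fin n)) (G : Finset (Fin m)) {x x' : Fin n → ZMod 2}
    (h : ∀ v, v ∉ xverts I F → v ∉ P → x v = x' v) : freeP I y F P T C G x = freeP I y F P T C G x' := by
  unfold freeP
  congr 1
  · congr 1
    · exact sum_congr rfl fun v hv => h v (mem_filter.1 hv).2.1 (mem_filter.1 hv).2.2
    · refine sum_congr rfl fun j hj => ?_
      rw [h _ (not_mem_xverts_of_two_le I hT _ j (s := 2) (by decide)) (hPF j (hTF hj)).1,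
        h _ (not_mem_xverts_of_two_le I hT _ j (s := 3) (by decide)) (hPF j (hTF hj)).2]
  · refine sum_congr rfl fun g hg => ?_
    have hg' := (mem_filter.1 hg).2
    push Not at hg'
    rw [h _ (not_mem_xverts_of_two_le I hT _ g (s := 2) (by decide)) hg'.1, h _ (not_mem_xverts_of_two_le I hT _ g (s := 3) (by decide)) hg'.2]

end Summit.PneNP.PneNP.Theorems.PstarHalfChordBridgeTools
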